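/-
Copyright (c) 2026 the pub-hodgecm-mathlib formalisation cell (harness21).  Prover seat hodgecm-mathlib-A-p03 (g24); LEAD F0P3a-plan (g9) WORD T8-41 «(F4)–(F8) PEN 1»;
LAYER B_H (B-p14 (g30) census 8d487f29 §3), 2026-09-01.
-/
import Literature.NumberTheory.Automorphic.UnitaryThreeBorelCosetCountGeneralRatioQuadratic
import Literature.NumberTheory.Rogawski1990.UnitOrbitalIntegralInertCountJPos          -- ★ casts, `v_pow_…_iff`
import Literature.NumberTheory.Automorphic.UnitaryThreePHTowerPackage                   -- ★ B-p04 Prop. 8 package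
import HarnessLib

/-!
# Flicker's Prop. 10 for a general off-diagonal ratio: `#{y ∈ P_H⧸(P_H ∩ H^K_m) : y⁻¹ τ y ∈ H^K_m} = iTen q ν N₊ m` for `τ = !![A,0,B₂p; 0,b,0; B₂,0,A]`

Topic `NumberTheory/Rogawski1990` (road «D-N7-inert», MAP v3 (F4)∕(F11) LAYER B_H); namespace `Literature.NumberTheory.Automorphic.UnitaryGroup`.  THEOREMS ONLY: no
definition, no named fact, no instance, no notation, no `sorry`; kernel lane.

The `T_H` clause of Prop. 10 (Flicker p. 85, second half: the table `iTen q ν (1+N₂) m`) and the type-(1) clause (`iTen q ν N₊ m`, ★ `natCard_cosets_eq_iTen`) are ONE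
statement once the off-diagonal ratio `p = B₁∕B₂` (type (1): `ϖ^{2j}`; `T_H`: `(π∕D)ϖ^{2j′}`-like, odd order) is a parameter with `|p| < 1`, `σp = p`:
**`natCard_cosets_eq_iTen_gen`** (six-way dispatch over ★ `…GeneralRatio` ∕ `…GeneralRatioQuadratic`, Prop. 8's numbers as hypotheses) and
**`natCard_cosets_eq_iTen_gen_of_package`** (those discharged by ★ B-p04's `UnitaryThreePHTowerPackage`).  The `T_H`-literal adapter (valuations `|B₂| = |ϖ^ν|`,
`|A − ι| = |ϖ^M|`, σ-defect) follows in LAYER B_H's last file once B-p12∕B-p14 fix the `T_H` and ramified-`r_j` literals.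
HONEST LABEL: HC_CM is proved only modulo the printed citations until rung 0 closes.

## References
* [Flicker1998UnitaryFL] Y. Z. Flicker, *Elementary proof of the fundamental lemma for a unitary group*, Canad. J. Math. 50 (1998), 74–98: Prop. 10 pp. 85–86 (both clauses).
* [Rogawski1990] J. D. Rogawski, *Automorphic Representations of Unitary Groups in Three Variables* (1990), §4.9 p. 55.
-/

set_option autoImplicit false

open scoped MatrixGroups WithZero Valued
open Matrix

namespace Literature.NumberTheory.Automorphic

namespace UnitaryGroup

open Literature.NumberTheory.Automorphic.HermitianLattice (unitaryInt mem_unitaryInt_iff LocalConjDatum)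
open Literature.NumberTheory.Rogawski1990.Flicker1998 (iTen)
open IsLocalRing

variable {K : Type*} [Field K] [Valued K ℤᵐ⁰] {ϖ : K} (σ : K →+* K) {J : Matrix (Fin 3) (Fin 3) K}

section PropTenGen

variable [IsDiscreteValuationRing 𝒪[K]] [Finite (ResidueField 𝒪[K])] [IsAdicComplete (maximalIdeal 𝒪[K]) 𝒪[K]]

/-- **FLICKER'S PROPOSITION 10, GENERAL RATIO** (both clauses): for `τ = !![A,0,B₁; 0,b,0; B₂,0,A] ∈ H` with `B₁ = B₂·p`, `|p| < 1`, `σp = p`, `|B₂| = |ϖ^ν|`, `|A − b| = |ϖ^{N₊}|`, the number of cosets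
`y ∈ P_H ⧸ (P_H ∩ H^K_m)` with `y⁻¹ τ y ∈ H^K_m` is the printed table ★ `iTen q ν N₊ m` — given Prop. 8's index (`hidx0`, `hidx`) and the fibre size `q^m` of `ρ_m` (`hfib`),
both (F3c-β) (B-p04 (g33)), and the σ-defect bound `hσd` of `d = 2(A−b)∕B₂` in the fourth regime (from ★ `map_ratio_sub_ratio` at the eigenvalues).
[cite: Flicker1998UnitaryFL, Prop. 10 pp. 85–86] -/
theorem natCard_cosets_eq_iTen_gen (hJ : J = (StdForm.antidiagonal 3).over K) (hd : LocalConjDatum σ ϖ)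
    (hσO : ∀ y : 𝒪[K], (σ.comp 𝒪[K].subtype) y ∈ 𝒪[K]) {y : K} (hy : y * σ y = -2)
    {m ν Np : ℕ}
    {c um τ : ↥(unitaryGroupOfForm σ J)} (hc : ((c : GL (Fin 3) K) : Matrix (Fin 3) (Fin 3) K) = !![1, 0, 0; 0, -1, 0; 0, 0, 1])
    (hum : ((um : GL (Fin 3) K) : Matrix (Fin 3) (Fin 3) K) = !![ϖ ^ m, y, (ϖ ^ m)⁻¹; 0, 1, -σ y * (ϖ ^ m)⁻¹; 0, 0, (ϖ ^ m)⁻¹])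
    {A B₁ B₂ b p : K} (hB₁ : B₁ = B₂ * p) (hvp : Valued.v p < 1) (hσp : σ p = p)
    (hτ : ((τ : GL (Fin 3) K) : Matrix (Fin 3) (Fin 3) K) = !![A, 0, B₁; 0, b, 0; B₂, 0, A])
    (hτH : τ ∈ Subgroup.centralizer ({c} : Set ↥(unitaryGroupOfForm σ J)))
    (hB₂ : Valued.v B₂ = Valued.v (ϖ ^ ν)) (hs : Valued.v (A - b) = Valued.v (ϖ ^ Np))
    (hσd : Np = ν → m ≤ ν → ν < 2 * m → Valued.v (σ (2 * (A - b) / B₂) - 2 * (A - b) / B₂) ≤ Valued.v (ϖ ^ (2 * m - ν)))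
    {q : ℕ} (hq : Nat.card (ResidueField 𝒪[K]) = q ^ 2)
    {a₀ : 𝒪[K]} (ha₀ : IsUnit (((σ.comp 𝒪[K].subtype).codRestrict 𝒪[K] hσO) a₀ - a₀))
    (hidx0 : m = 0 → ((flickerHK σ J c um).subgroupOf (flickerPH σ J c)).index = 1)
    (hidx : 1 ≤ m → ((flickerHK σ J c um).subgroupOf (flickerPH σ J c)).index = (q ^ 2 - 1) * q ^ (4 * m - 2))
    (hSN : flickerPH σ J c ⊓ flickerHK σ J c um ≤ flickerPH0 σ J c (ϖ ^ m))
    [Finite (↥(flickerPH σ J c) ⧸ (flickerHK σ J c um).subgroupOf (flickerPH σ J c))]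
    (hfib : ∀ z ∈ Set.range (fun w : ↥(flickerPH σ J c) ⧸ (flickerHK σ J c um).subgroupOf (flickerPH σ J c) =>
        flickerPHRho σ m ((Quotient.out w : ↥(flickerPH σ J c)) : ↥(unitaryGroupOfForm σ J))),
      Nat.card {w : ↥(flickerPH σ J c) ⧸ (flickerHK σ J c um).subgroupOf (flickerPH σ J c) //
        flickerPHRho σ m ((Quotient.out w : ↥(flickerPH σ J c)) : ↥(unitaryGroupOfForm σ J)) = z} = q ^ m) :
    (Nat.card {w : ↥(flickerPH σ J c) ⧸ (flickerHK σ J c um).subgroupOf (flickerPH σ J c) //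
      ((Quotient.out w : ↥(flickerPH σ J c)) : ↥(unitaryGroupOfForm σ J))⁻¹ * τ * (Quotient.out w : ↥(flickerPH σ J c)) ∈ flickerHK σ J c um} : ℚ) =
      iTen q ν Np m := by
  have hq0 : q ≠ 0 := by
    rintro rfl
    have h1 : 0 < Nat.card (ResidueField 𝒪[K]) := Nat.card_pos
    rw [hq] at h1; simp at h1
  have hϖ0 : ϖ ≠ 0 := hd.ϖ_ne_zero
  have hB₂0 : B₂ ≠ 0 := fun h => by
    rw [h, map_zero] at hB₂; exact (pow_ne_zero _ hϖ0) ((map_eq_zero _).1 hB₂.symm)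
  have hvmm : Valued.v (ϖ ^ m) * Valued.v (ϖ ^ m) = Valued.v (ϖ ^ (2 * m)) := by rw [← map_mul, ← pow_add, two_mul]
  rcases Nat.eq_zero_or_pos m with hm0 | hm
  · -- m = 0 : everything solves, one coset
    subst hm0
    have hall := natCard_cosets_eq_index_of_le_gen σ hJ hd hy 0 hc hum hB₁ hvp.le hτ hτH
      (by rw [hs, hvmm, v_pow_le_v_pow_iff σ hd]; omega) (by rw [hB₂, hvmm, v_pow_le_v_pow_iff σ hd]; omega)
    rw [hall, hidx0 rfl, iTen, if_pos rfl, Nat.cast_one]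
  have hm0 : m ≠ 0 := by omega
  by_cases hνm : ν < m
  · -- regime «m > ν» : empty
    rw [natCard_cosets_eq_zero_of_lt_gen σ hJ hd hy m hc hum hB₁ hvp hB₂0 hτ hτH (by rw [hB₂, v_pow_lt_v_pow_iff σ hd]; exact hνm),
      iTen, if_neg hm0, if_neg (by omega), if_neg (by omega), Nat.cast_zero]
  have hmν : m ≤ ν := by omega
  have hB₂m : Valued.v B₂ ≤ Valued.v (ϖ ^ m) := by rw [hB₂, v_pow_le_v_pow_iff σ hd]; exact hmν
  by_cases hNp : Np < m
  · -- regime «N₊ < m» : no solution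
    rw [natCard_cosets_eq_zero_of_ne_gen σ hJ hd hy m hc hum hB₁ hvp hB₂0 hτ hτH hB₂m
      (Or.inl (by rw [hs, v_pow_lt_v_pow_iff σ hd]; exact hNp)),
      iTen, if_neg hm0, if_neg (by omega), if_neg (by omega), Nat.cast_zero]
  have hmNp : m ≤ Np := by omega
  by_cases hboth : 2 * m ≤ ν ∧ 2 * m ≤ Np
  · -- regime «all» : the full index
    have hall := natCard_cosets_eq_index_of_le_gen σ hJ hd hy m hc hum hB₁ hvp.le hτ hτH
      (by rw [hs, hvmm, v_pow_le_v_pow_iff σ hd]; exact hboth.2) (by rw [hB₂, hvmm, v_pow_le_v_pow_iff σ hd]; exact hboth.1)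
    rw [hall, hidx hm, cast_index_eq hq0 hm, iTen, if_neg hm0, if_pos (by omega)]
  by_cases hνNp : ν = Np
  · -- regime «ν = N₊ < 2m» : the quadratic count
    subst hνNp
    have hν2m : ν < 2 * m := by omega
    obtain ⟨r, hr⟩ : ∃ r, ν = m + r := ⟨ν - m, by omega⟩
    obtain ⟨k', hk'⟩ : ∃ k', m = k' + 1 + r := ⟨m - r - 1, by omega⟩
    have hreg := natCard_cosets_regime_four_gen σ hJ hd hσO hy (k := k' + 1) hm hmν (by omega) (by omega) hc hum hB₁ hvp hσp hτ hτH hB₂ hs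
      (by have := hσd rfl hmν hν2m; rwa [show 2 * m - ν = k' + 1 by omega] at this) hq ha₀ hSN hfib
    rw [hreg, iTen, if_neg hm0, if_neg (by omega), if_pos ⟨rfl, hν2m, hmν⟩,
      show m - (k' + 1) = r by omega, show m - 1 = k' + r by omega, hk', cast_regime_four_eq hq0 k' r]
    congr 2; omega
  · -- regime «ν ≠ N₊ beyond the square root» : no solution
    have hne : Valued.v (A - b) ≠ Valued.v B₂ := by
      rw [hs, hB₂, Ne, v_pow_eq_v_pow_iff σ hd]; exact fun h => hνNp h.symm
    have hbig : Valued.v (ϖ ^ m) * Valued.v (ϖ ^ m) < max (Valued.v (A - b)) (Valued.v B₂) := by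
      rw [hvmm, hs, hB₂]
      rcases not_and_or.1 hboth with h | h
      · exact lt_max_of_lt_right (by rw [v_pow_lt_v_pow_iff σ hd]; omega)
      · exact lt_max_of_lt_left (by rw [v_pow_lt_v_pow_iff σ hd]; omega)
    rw [natCard_cosets_eq_zero_of_ne_gen σ hJ hd hy m hc hum hB₁ hvp hB₂0 hτ hτH hB₂m (Or.inr ⟨hne, hbig⟩),
      iTen, if_neg hm0, if_neg (by omega), if_neg (by rintro ⟨h, -, -⟩; exact hνNp h), Nat.cast_zero]


/-- **FLICKER'S PROPOSITION 10, GENERAL RATIO**, Prop. 8's numbers discharged by ★ B-p04's package: for `τ = !![A,0,B₂p; 0,b,0; B₂,0,A] ∈ H` (`|p| < 1`, `σp = p`) with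
`|B₂| = |ϖ^ν|`, `|A − b| = |ϖ^{N₊}|`: `#{y ∈ P_H ⧸ (P_H ∩ H^K_m) : y⁻¹ τ y ∈ H^K_m} = iTen q ν N₊ m` (as a rational number), for every `m`.
[cite: Flicker1998UnitaryFL, Prop. 10 pp. 85–86; Prop. 8 p. 84] -/
theorem natCard_cosets_eq_iTen_gen_of_package (hJ : J = (StdForm.antidiagonal 3).over K) (hd : LocalConjDatum σ ϖ)
    (hσO : ∀ y : 𝒪[K], (σ.comp 𝒪[K].subtype) y ∈ 𝒪[K]) {y : K} (hy : y * σ y = -2)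
    {m ν Np : ℕ}
    {c um τ : ↥(unitaryGroupOfForm σ J)} (hc : ((c : GL (Fin 3) K) : Matrix (Fin 3) (Fin 3) K) = !![1, 0, 0; 0, -1, 0; 0, 0, 1])
    (hum : ((um : GL (Fin 3) K) : Matrix (Fin 3) (Fin 3) K) = !![ϖ ^ m, y, (ϖ ^ m)⁻¹; 0, 1, -σ y * (ϖ ^ m)⁻¹; 0, 0, (ϖ ^ m)⁻¹])
    {A B₁ B₂ b p : K} (hB₁ : B₁ = B₂ * p) (hvp : Valued.v p < 1) (hσp : σ p = p)
    (hτ : ((τ : GL (Fin 3) K) : Matrix (Fin 3) (Fin 3) K) = !![A, 0, B₁; 0, b, 0; B₂, 0, A])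
    (hτH : τ ∈ Subgroup.centralizer ({c} : Set ↥(unitaryGroupOfForm σ J)))
    (hB₂ : Valued.v B₂ = Valued.v (ϖ ^ ν)) (hs : Valued.v (A - b) = Valued.v (ϖ ^ Np))
    (hσd : Np = ν → m ≤ ν → ν < 2 * m → Valued.v (σ (2 * (A - b) / B₂) - 2 * (A - b) / B₂) ≤ Valued.v (ϖ ^ (2 * m - ν)))
    {q : ℕ} (hq : Nat.card (ResidueField 𝒪[K]) = q ^ 2)
    {a₀ : 𝒪[K]} (ha₀ : IsUnit (((σ.comp 𝒪[K].subtype).codRestrict 𝒪[K] hσO) a₀ - a₀)) :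
    (Nat.card {w : ↥(flickerPH σ J c) ⧸ (flickerHK σ J c um).subgroupOf (flickerPH σ J c) //
      ((Quotient.out w : ↥(flickerPH σ J c)) : ↥(unitaryGroupOfForm σ J))⁻¹ * τ * (Quotient.out w : ↥(flickerPH σ J c)) ∈ flickerHK σ J c um} : ℚ) =
      iTen q ν Np m := by
  haveI := finite_quotient_flickerHK σ hJ hd hy hσO m hum hc hq ha₀
  refine natCard_cosets_eq_iTen_gen σ hJ hd hσO hy hc hum hB₁ hvp hσp hτ hτH hB₂ hs hσd hq ha₀ ?_ ?_
    (inf_flickerHK_le_flickerPH0 σ hJ hd hy m hum hc) (natCard_fibre_flickerPHRho_eq σ hJ hd hy hσO m hum hc hq ha₀)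
  · rintro rfl
    exact index_flickerHK_subgroupOf_flickerPH_eq_one σ hJ hd hy hσO hum hc hq ha₀
  · intro hm
    exact index_flickerHK_subgroupOf_flickerPH_eq σ hJ hd hy hσO hm hum hc hq ha₀


end PropTenGen

end UnitaryGroup

end Literature.NumberTheory.Automorphic
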